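import Mathlib
import Literature.Analysis.SpecialFunctions.BesselHeatKernelGreen
import Literature.Analysis.SpecialFunctions.BesselHeatKernelApproxIdentityPoly
import HarnessLib

/-!
# The Chapman–Kolmogorov pairing of two radial heat kernels: continuity in time and the endpoint limits

For `μ, ν ≥ 0`, `t, x, y > 0` consider the pairing `D(s) = ∫_0^∞ q^{(ν)}_{t-s}(x,z) q^{(μ)}_s(y,z) z dz` (`0 < s < t`) of the
kernels of `BesselHeatKernel.lean` (measure `z dz`).  This file proves the ENDPOINT LIMITS of the Duhamel comparison
[RevuzYor1999, Ch. XI §1]: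
* `tendsto_duhamelPairing_zero` — `D(s) → q^{(ν)}_t(x,y)` as `s → 0⁺` (approximate identity of `q^{(μ)}_s(y,·)`);
* `tendsto_duhamelPairing_top`  — `D(s) → q^{(μ)}_t(x,y)` as `s → t⁻` (approximate identity of `q^{(ν)}_{t-s}(x,·)`),
via `tendsto_integral_besselHeatKernel_approx_of_le_rpow` applied to the capped test kernel `q_{max(t-s, t/2)}` (polynomially
bounded: `besselHeatKernel_le_rpow_of_mem_Icc`) and the joint continuity of `(t,z) ↦ q^{(κ)}_t(x,z)`
(`continuousOn_besselHeatKernel_time_right`; also `continuousOn_besselHeatKernel_time`).  Together with Green's identity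
(`integral_green_besselHeatKernel`) for `D′`, these give `q^{(μ)}_t - q^{(ν)}_t = (ν²-μ²)/2 ∫_0^t ∫ q^{(ν)}_{t-s} q^{(μ)}_s z⁻¹`
(the differentiation of `D` under the integral sign is the remaining step, not in this file).

## References
* D. Revuz, M. Yor, *Continuous Martingales and Brownian Motion*, 3rd ed. (1999), Ch. XI §1. [RevuzYor1999]
-/

noncomputable section

open Filter Topology Real MeasureTheory Set
open scoped Nat BigOperators

namespace Literature.Analysis.SpecialFunctions

section Duhamel

variable {μ ν t x y : ℝ}

/-- `t ↦ q^{(ν)}_t(x,y)` is continuous on `(0,∞)`. [cite: RevuzYor1999, Ch. XI §1] -/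
theorem continuousOn_besselHeatKernel_time (hν : 0 ≤ ν) (x y : ℝ) :
    ContinuousOn (fun τ : ℝ => besselHeatKernel ν τ x y) (Ioi 0) := by
  intro τ hτ
  have hτ' : (0 : ℝ) < τ := hτ
  have hτ0 : τ ≠ 0 := hτ'.ne'
  unfold besselHeatKernel
  have h1 : ContinuousAt (fun τ : ℝ => τ⁻¹) τ := continuousAt_inv₀ hτ0
  have h2 : ContinuousAt (fun τ : ℝ => Real.exp (-(x ^ 2 + y ^ 2) / (2 * τ))) τ :=
    (Real.continuous_exp.continuousAt).comp (ContinuousAt.div continuousAt_const (by fun_prop) (by positivity))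
  have h3 : ContinuousAt (fun τ : ℝ => besselIR ν (x * y / τ)) τ :=
    ((continuous_besselIR hν).continuousAt).comp (ContinuousAt.div continuousAt_const continuousAt_id hτ0)
  exact ((h1.mul h2).mul h3).continuousWithinAt

/-- `(t,z) ↦ q^{(ν)}_t(x,z)` is jointly continuous on `(0,∞) × ℝ`. [cite: RevuzYor1999, Ch. XI §1] -/
theorem continuousOn_besselHeatKernel_time_right (hν : 0 ≤ ν) (x : ℝ) :
    ContinuousOn (fun p : ℝ × ℝ => besselHeatKernel ν p.1 x p.2) (Ioi 0 ×ˢ univ) := by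
  intro p hp
  have hτ' : (0 : ℝ) < p.1 := hp.1
  have hτ0 : p.1 ≠ 0 := hτ'.ne'
  unfold besselHeatKernel
  have h1 : ContinuousAt (fun p : ℝ × ℝ => p.1⁻¹) p := (continuousAt_inv₀ hτ0).comp continuousAt_fst
  have h2 : ContinuousAt (fun p : ℝ × ℝ => Real.exp (-(x ^ 2 + p.2 ^ 2) / (2 * p.1))) p :=
    (Real.continuous_exp.continuousAt).comp (ContinuousAt.div (by fun_prop) (by fun_prop) (by positivity))
  have h3 : ContinuousAt (fun p : ℝ × ℝ => besselIR ν (x * p.2 / p.1)) p :=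
    ((continuous_besselIR hν).continuousAt).comp (ContinuousAt.div (by fun_prop) continuousAt_fst hτ0)
  exact ((h1.mul h2).mul h3).continuousWithinAt

/-- A kernel with time in `[t/2, t]` is polynomially bounded: `q^{(ν)}_τ(x,z) ≤ (2/t)(x/t)^ν/Γ(ν+1) · z^ν`. [cite: RevuzYor1999, Ch. XI §1] -/
theorem besselHeatKernel_le_rpow_of_mem_Icc (hν : 0 ≤ ν) (ht : 0 < t) (hx : 0 < x) {τ z : ℝ}
    (hτ : τ ∈ Icc (t / 2) t) (hz : 0 < z) :
    besselHeatKernel ν τ x z ≤ (2 / t) * (x / t) ^ ν / Real.Gamma (ν + 1) * z ^ ν := by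
  have hτ0 : 0 < τ := lt_of_lt_of_le (by positivity) hτ.1
  have hG : 0 < Real.Gamma (ν + 1) := Real.Gamma_pos_of_pos (by linarith)
  have h := besselHeatKernel_le hν hτ0 hx.le hz.le
  have h1 : Real.exp (-(x - z) ^ 2 / (2 * τ)) ≤ 1 := by
    rw [Real.exp_le_one_iff]
    apply div_nonpos_of_nonpos_of_nonneg <;> [nlinarith [sq_nonneg (x - z)]; positivity]
  have h2 : τ⁻¹ ≤ 2 / t := by
    rw [inv_eq_one_div, div_le_div_iff₀ hτ0 ht]; linarith [hτ.1]
  have h3 : (x * z / (2 * τ)) ^ ν ≤ (x / t) ^ ν * z ^ ν := by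
    rw [← Real.mul_rpow (by positivity) hz.le]
    refine Real.rpow_le_rpow (by positivity) ?_ hν
    rw [div_mul_eq_mul_div, div_le_div_iff₀ (by positivity) ht]
    nlinarith [hτ.1, mul_pos hx hz]
  calc besselHeatKernel ν τ x z ≤ τ⁻¹ * (x * z / (2 * τ)) ^ ν * Real.exp (-(x - z) ^ 2 / (2 * τ)) / Real.Gamma (ν + 1) := h
    _ ≤ (2 / t) * ((x / t) ^ ν * z ^ ν) * 1 / Real.Gamma (ν + 1) := by
        gcongr
    _ = (2 / t) * (x / t) ^ ν / Real.Gamma (ν + 1) * z ^ ν := by ring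

/-- **Endpoint `s → 0⁺`**: `∫ q^{(ν)}_{t-s}(x,z) q^{(μ)}_s(y,z) z dz → q^{(ν)}_t(x,y)` (approximate identity of `q^{(μ)}_s(y,·)`).
[cite: RevuzYor1999, Ch. XI §1] -/
theorem tendsto_duhamelPairing_zero (hμ : 0 ≤ μ) (hν : 0 ≤ ν) (ht : 0 < t) (hx : 0 < x) (hy : 0 < y) :
    Tendsto (fun s : ℝ => ∫ z in Ioi (0 : ℝ), besselHeatKernel ν (t - s) x z * besselHeatKernel μ s y z * z)
      (𝓝[>] 0) (𝓝 (besselHeatKernel ν t x y)) := by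
  -- the capped test function
  set G : ℝ → ℝ → ℝ := fun s z => besselHeatKernel ν (max (t - s) (t / 2)) x z with hG
  have hmem : ∀ s, 0 ≤ s → max (t - s) (t / 2) ∈ Icc (t / 2) t := fun s hs =>
    ⟨le_max_right _ _, max_le (by linarith) (by linarith)⟩
  -- (1) measurability
  have hGm : ∀ s, 0 < s → AEStronglyMeasurable (G s) (volume.restrict (Ioi 0)) := fun s _ =>
    (continuous_besselHeatKernel_right hν _ x).aestronglyMeasurable
  -- (2) polynomial bound
  have hGb : ∀ s z, 0 < s → 0 < z → |G s z| ≤ ((2 / t) * (x / t) ^ ν / Real.Gamma (ν + 1)) * (1 + z ^ ν) := by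
    intro s z hs hz
    have hτ := hmem s hs.le
    have hτ0 : 0 < max (t - s) (t / 2) := lt_of_lt_of_le (by positivity) hτ.1
    have hpos : 0 ≤ G s z := (besselHeatKernel_pos hν hτ0 hx hz).le
    rw [abs_of_nonneg hpos]
    have h := besselHeatKernel_le_rpow_of_mem_Icc hν ht hx hτ hz
    have hC : 0 ≤ (2 / t) * (x / t) ^ ν / Real.Gamma (ν + 1) := by
      have := Real.Gamma_pos_of_pos (show 0 < ν + 1 by linarith); positivity
    calc G s z ≤ (2 / t) * (x / t) ^ ν / Real.Gamma (ν + 1) * z ^ ν := h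
      _ ≤ (2 / t) * (x / t) ^ ν / Real.Gamma (ν + 1) * (1 + z ^ ν) := by
          refine mul_le_mul_of_nonneg_left ?_ hC; linarith
  -- (3) continuity at `(0⁺, y)`
  have hGc : ∀ ε > 0, ∃ δ > 0, ∀ s z, 0 < s → s < δ → 0 < z → |z - y| < δ →
      |G s z - besselHeatKernel ν t x y| < ε := by
    intro ε hε
    have hH : ContinuousAt (fun p : ℝ × ℝ => besselHeatKernel ν (max (t - p.1) (t / 2)) x p.2) (0, y) := by
      have hφ : ContinuousAt (fun p : ℝ × ℝ => (max (t - p.1) (t / 2), p.2)) (0, y) := by fun_prop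
      have hval : (fun p : ℝ × ℝ => (max (t - p.1) (t / 2), p.2)) (0, y) = (t, y) := by
        simp only [sub_zero]; rw [max_eq_left (by linarith)]
      have hK := continuousOn_besselHeatKernel_time_right hν x (t, y) ⟨ht, mem_univ _⟩
      have hKat : ContinuousAt (fun p : ℝ × ℝ => besselHeatKernel ν p.1 x p.2) (t, y) :=
        hK.continuousAt ((isOpen_Ioi.prod isOpen_univ).mem_nhds ⟨ht, mem_univ _⟩)
      exact ContinuousAt.comp_of_eq hKat hφ hval
    have hval0 : besselHeatKernel ν (max (t - 0) (t / 2)) x y = besselHeatKernel ν t x y := by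
      rw [sub_zero, max_eq_left (by linarith)]
    obtain ⟨δ, hδ, hδ'⟩ := Metric.continuousAt_iff.1 hH ε hε
    refine ⟨δ, hδ, fun s z hs hsδ hz hzy => ?_⟩
    have hd : dist ((s, z) : ℝ × ℝ) (0, y) < δ := by
      rw [Prod.dist_eq, Real.dist_eq, Real.dist_eq, sub_zero, abs_of_pos hs]
      exact max_lt hsδ hzy
    have := hδ' hd
    rw [Real.dist_eq, hval0] at this
    simpa [hG] using this
  have happrox := tendsto_integral_besselHeatKernel_approx_of_le_rpow hμ hy hν hGm hGb hGc
  -- the pairing agrees with the capped one for `s < t/2`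
  refine happrox.congr' ?_
  filter_upwards [Ioo_mem_nhdsGT (show (0 : ℝ) < t / 2 by positivity)] with s hs
  refine setIntegral_congr_fun measurableSet_Ioi fun z _ => ?_
  have : max (t - s) (t / 2) = t - s := max_eq_left (by linarith [hs.2])
  simp only [hG, this]
  ring

/-- **Endpoint `s → t⁻`**: `∫ q^{(ν)}_{t-s}(x,z) q^{(μ)}_s(y,z) z dz → q^{(μ)}_t(x,y)` (approximate identity of `q^{(ν)}_{t-s}(x,·)`).
[cite: RevuzYor1999, Ch. XI §1] -/
theorem tendsto_duhamelPairing_top (hμ : 0 ≤ μ) (hν : 0 ≤ ν) (ht : 0 < t) (hx : 0 < x) (hy : 0 < y) :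
    Tendsto (fun s : ℝ => ∫ z in Ioi (0 : ℝ), besselHeatKernel ν (t - s) x z * besselHeatKernel μ s y z * z)
      (𝓝[<] t) (𝓝 (besselHeatKernel μ t x y)) := by
  -- capped test function in the variable `τ = t - s → 0⁺`
  set G : ℝ → ℝ → ℝ := fun τ z => besselHeatKernel μ (max (t - τ) (t / 2)) y z with hG
  have hmem : ∀ τ, 0 ≤ τ → max (t - τ) (t / 2) ∈ Icc (t / 2) t := fun τ hτ =>
    ⟨le_max_right _ _, max_le (by linarith) (by linarith)⟩
  have hGm : ∀ τ, 0 < τ → AEStronglyMeasurable (G τ) (volume.restrict (Ioi 0)) := fun τ _ =>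
    (continuous_besselHeatKernel_right hμ _ y).aestronglyMeasurable
  have hGb : ∀ τ z, 0 < τ → 0 < z → |G τ z| ≤ ((2 / t) * (y / t) ^ μ / Real.Gamma (μ + 1)) * (1 + z ^ μ) := by
    intro τ z hτ hz
    have hτ' := hmem τ hτ.le
    have hτ0 : 0 < max (t - τ) (t / 2) := lt_of_lt_of_le (by positivity) hτ'.1
    have hpos : 0 ≤ G τ z := (besselHeatKernel_pos hμ hτ0 hy hz).le
    rw [abs_of_nonneg hpos]
    have h := besselHeatKernel_le_rpow_of_mem_Icc hμ ht hy hτ' hz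
    have hC : 0 ≤ (2 / t) * (y / t) ^ μ / Real.Gamma (μ + 1) := by
      have := Real.Gamma_pos_of_pos (show 0 < μ + 1 by linarith); positivity
    calc G τ z ≤ (2 / t) * (y / t) ^ μ / Real.Gamma (μ + 1) * z ^ μ := h
      _ ≤ (2 / t) * (y / t) ^ μ / Real.Gamma (μ + 1) * (1 + z ^ μ) := by
          refine mul_le_mul_of_nonneg_left ?_ hC; linarith
  have hGc : ∀ ε > 0, ∃ δ > 0, ∀ τ z, 0 < τ → τ < δ → 0 < z → |z - x| < δ →
      |G τ z - besselHeatKernel μ t y x| < ε := by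
    intro ε hε
    have hH : ContinuousAt (fun p : ℝ × ℝ => besselHeatKernel μ (max (t - p.1) (t / 2)) y p.2) (0, x) := by
      have hφ : ContinuousAt (fun p : ℝ × ℝ => (max (t - p.1) (t / 2), p.2)) (0, x) := by fun_prop
      have hval : (fun p : ℝ × ℝ => (max (t - p.1) (t / 2), p.2)) (0, x) = (t, x) := by
        simp only [sub_zero]; rw [max_eq_left (by linarith)]
      have hK := continuousOn_besselHeatKernel_time_right hμ y (t, x) ⟨ht, mem_univ _⟩
      have hKat : ContinuousAt (fun p : ℝ × ℝ => besselHeatKernel μ p.1 y p.2) (t, x) :=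
        hK.continuousAt ((isOpen_Ioi.prod isOpen_univ).mem_nhds ⟨ht, mem_univ _⟩)
      exact ContinuousAt.comp_of_eq hKat hφ hval
    have hval0 : besselHeatKernel μ (max (t - 0) (t / 2)) y x = besselHeatKernel μ t y x := by
      rw [sub_zero, max_eq_left (by linarith)]
    obtain ⟨δ, hδ, hδ'⟩ := Metric.continuousAt_iff.1 hH ε hε
    refine ⟨δ, hδ, fun τ z hτ hτδ hz hzx => ?_⟩
    have hd : dist ((τ, z) : ℝ × ℝ) (0, x) < δ := by
      rw [Prod.dist_eq, Real.dist_eq, Real.dist_eq, sub_zero, abs_of_pos hτ]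
      exact max_lt hτδ hzx
    have := hδ' hd
    rw [Real.dist_eq, hval0] at this
    simpa [hG] using this
  have happrox := tendsto_integral_besselHeatKernel_approx_of_le_rpow hν hx hμ hGm hGb hGc
  rw [besselHeatKernel_symm μ t y x] at happrox
  -- change of variable `τ = t - s`
  have h1 : Tendsto (fun s : ℝ => t - s) (𝓝[<] t) (𝓝 0) := by
    have h : Tendsto (fun s : ℝ => t - s) (𝓝 t) (𝓝 (t - t)) := tendsto_const_nhds.sub tendsto_id
    rw [sub_self] at h
    exact h.mono_left nhdsWithin_le_nhds
  have h2 : ∀ᶠ s in 𝓝[<] t, t - s ∈ Ioi (0 : ℝ) := by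
    filter_upwards [self_mem_nhdsWithin] with s (hs : s < t)
    exact sub_pos.2 hs
  have h3 : Tendsto (fun s : ℝ => t - s) (𝓝[<] t) (𝓝[>] 0) := tendsto_nhdsWithin_iff.2 ⟨h1, h2⟩
  refine ((happrox.comp h3).congr' ?_)
  filter_upwards [Ioo_mem_nhdsLT (show t / 2 < t by linarith)] with s hs
  simp only [Function.comp]
  refine setIntegral_congr_fun measurableSet_Ioi fun z _ => ?_
  have : max (t - (t - s)) (t / 2) = s := by rw [sub_sub_cancel]; exact max_eq_left (by linarith [hs.1])
  simp only [hG, this]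
  try ring

end Duhamel

end Literature.Analysis.SpecialFunctions

end
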